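import Mathlib
import HarnessLib
import Summits.CriticalPhenomena.SAWScalingLimit.Theses.SAWRenewalTightness
import Literature.Probability.RandomPlanarGeometry.SAWCount

/-!
# Sketch — crux-ideate stmt-CriticalPhenomena-4728 (ShellCrossingBound), ideator 3 (gen 2), round 1

First lemmas of the third idea card `pinch-surgery-amplification`, typed over existing
declarations (no proofs claimed):

* `LoopDetourRatio` — the ONE probabilistic input of the card (a scale-free RATIO form of an
  RSW-type estimate for the critical ℤ² SAW): between two lattice points at distance `≤ s`, the
  x_c-mass of self-avoiding connections making a detour to distance `≥ L` is at most
  `C (s/L)^θ` times the x_c-mass of the connections staying within distance `4s`.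
  Predicted `θ = 2/3` (from `c_n(x) x_c^n ≍ n^{-3/2}` for `n^{3/4} ≫ |x|`, i.e. γ = 43/32,
  ν = 3/4, θ₀ = 11/24); the card's amplification needs `θ > 0` with many simultaneous sites
  (`θ > 1/2` in the crude √M-sites version); summing it over dyadic `L` IMPLIES finiteness of
  the critical two-point function `G_{x_c}(0,v) < ∞`, i.e. it is at least as strong as the
  sibling crux `CriticalBubbleBound` (stmt-CriticalPhenomena-7117).
* `NarrowStripDecay` — the provable-now base case of the card's "open up or descend"
  recursion: x_c-mass of SAWs confined to three lattice rows decays exponentially in the span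
  (μ of the 3-row strip is < μ(ℤ²); Kesten pattern theorem or a transfer-matrix bound).
-/

open scoped BigOperators Classical

namespace Summit.CriticalPhenomena.SAWScalingLimit.Cruxes.ShellCrossingBound.Ideator3G2

open Literature.Probability.RandomPlanarGeometry Literature.Probability.LatticeModels

/-- x_c-mass of the `n ≤ N`-step self-avoiding walks from `0` to `v` (vertex functions
`SAW.Zd.sawFun`) satisfying a constraint `P n ω`. -/
noncomputable def massTo (v : Site 2) (N : ℕ) (P : ℕ → (ℕ → Site 2) → Prop) : ℝ :=
  ∑ n ∈ Finset.range (N + 1),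
    ∑ _ω ∈ (SAW.Zd.sawFun 2 n v).filter (fun ω => P n ω), SAW.criticalFugacity ^ n

/-- `ReachesDist L n ω`: the walk visits a site at Euclidean distance `≥ L` from the origin. -/
def ReachesDist (L : ℝ) (n : ℕ) (ω : ℕ → Site 2) : Prop :=
  ∃ i, i ≤ n ∧ L ≤ dist (Site.toComplex (ω i)) 0

/-- `StaysWithin r n ω`: every visited site is at Euclidean distance `≤ r` from the origin. -/
def StaysWithin (r : ℝ) (n : ℕ) (ω : ℕ → Site 2) : Prop :=
  ∀ i, i ≤ n → dist (Site.toComplex (ω i)) 0 ≤ r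

/-- **Loop–detour ratio (LDR)** — the card's single probabilistic input. There are `θ > 0` and
`C` such that for every endpoint `v ≠ 0` with `|v| ≤ s`, `1 ≤ s`, every `L ≥ 2s` and every
length cut-off `N`: the x_c-mass of SAWs `0 → v` of length `≤ N` reaching distance `≥ L` is at
most `C (s/L)^θ` times the x_c-mass of ALL SAWs `0 → v` confined to the ball of radius `4s`
(a finite sum: such walks have at most `(8⌈s⌉+1)²` vertices). Ratio form: no absolute
normalisation, same endpoints on both sides, lattice units, scale-free. Predicted θ = 2/3.
Open; implies `G_{x_c}(0,v) < ∞` (sibling crux CriticalBubbleBound). -/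
def LoopDetourRatio : Prop :=
  ∃ θ C : ℝ, 0 < θ ∧ ∀ (v : Site 2) (s L : ℝ), v ≠ 0 → 1 ≤ s →
    dist (Site.toComplex v) 0 ≤ s → 2 * s ≤ L → ∀ N : ℕ,
      massTo v N (ReachesDist L) ≤
        C * (s / L) ^ θ * massTo v ((8 * ⌈s⌉₊ + 1) ^ 2) (StaysWithin (4 * s))

/-- The dyadic-shell form actually consumed by the surgery (each side a statement about one
scale; summing over `L = 2^j s` recovers `LoopDetourRatio` up to constants). -/
def LoopDetourRatioDyadic : Prop :=
  ∃ θ C : ℝ, 0 < θ ∧ ∀ (v : Site 2) (s L : ℝ), v ≠ 0 → 1 ≤ s →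
    dist (Site.toComplex v) 0 ≤ s → 2 * s ≤ L → ∀ N : ℕ,
      massTo v N (fun n ω => ReachesDist L n ω ∧ StaysWithin (2 * L) n ω) ≤
        C * (s / L) ^ θ * massTo v ((8 * ⌈s⌉₊ + 1) ^ 2) (StaysWithin (4 * s))

/-- **Narrow-strip decay** (provable now; base case of the card's descent): the x_c-mass of
`n`-step SAWs from `0` confined to the three rows `{0 ≤ x₁ ≤ 2}` whose endpoint has abscissa
`L` is `≤ C q^L` with `q < 1`, uniformly in the length cut-off — because the 3-row strip has
connective constant `< μ(ℤ²)` (transfer matrix / Kesten's pattern theorem), so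
`x_c · μ_strip < 1` and the span forces `n ≥ L`. -/
def NarrowStripDecay : Prop :=
  ∃ q C : ℝ, q < 1 ∧ ∀ (L : ℤ) (N : ℕ), 1 ≤ L →
    (∑ n ∈ Finset.range (N + 1),
      ∑ _ω ∈ (SAW.Zd.saws 2 n).filter
        (fun ω => (∀ i, i ≤ n → 0 ≤ ω i 1 ∧ ω i 1 ≤ 2) ∧ ω n 0 = L),
        SAW.criticalFugacity ^ n) ≤ C * q ^ (L : ℝ)

end Summit.CriticalPhenomena.SAWScalingLimit.Cruxes.ShellCrossingBound.Ideator3G2
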